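import Summits.Ventures.PercRepro.C025ProfilePLDSolidLiftFive
import Summits.Ventures.PercRepro.C025ProfilePLDUniformTwoLiftSevenCorollaries

/-!
# ANY SOLID, A SOLID AND A LINE, FREE POINTS: COROLLARIES OF THE LIFT IN m FOR SOLIDS (night-3 g31)

`proofs/NIGHT3-G31-TWOLIFT.md` §7.  With `PLDSolidLift.pld_disjointSum_uniform_four_ge_7_of_eRank_le_5` — (PLD)(M) ∧ rank M ≤ 5
⟹ (PLD)(M ⊕ U_{4,m}) for every `m ≥ 7` — and the landed closure system: (PLD), hence (through the bridge
`PLDBridge.rls_disjointSum_freeOn_of_pld`) C-025 at every `(p, q)` on every truncation of `N ⊕ free points`, for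
`N` = «any matroid of rank ≤ 3 ⊕ any solid with ≥ 7 points», «any (PLD)-matroid of rank ≤ 5 ⊕ such a solid»,
«any matroid whose simplification is paving, of rank ≤ 5, ⊕ such a solid», and «any matroid of rank ≤ 3 ⊕ such a solid ⊕ a line
with ≥ 4 points» (the solid first: rank ≤ 7 for the line lift).  No `def`, no `instance`, no notation.  Axioms: standard.
-/

open scoped Matroid

namespace PercRepro

open Finset ThmH

namespace PLDSolidLift

variable {α : Type} [DecidableEq α]

omit [DecidableEq α] in
/-- The rank of `truncate (freeOn F) 4` is at most `4`. -/
theorem eRank_solid_le (F : Finset α) : (@Matroid.truncate α (Matroid.freeOn (F : Set α)) (PLDTruncate.freeOn_finite' F) 4).eRank ≤ 4 := by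
  rw [Matroid.truncate_eRank]; exact min_le_right _ _

/-- (PLD) FOR «RANK ≤ 3 ⊕ ANY SOLID WITH ≥ 7 POINTS» (unconditional). -/
theorem pld_disjointSum_solid_of_eRank_le_three (M : Matroid α) [M.Finite] (h3 : M.eRank ≤ 3)
    (F : Finset α) (hF : 7 ≤ F.card) (h : Disjoint M.E (@Matroid.truncate α (Matroid.freeOn (F : Set α)) (PLDTruncate.freeOn_finite' F) 4).E) :
    haveI := PLDTruncate.freeOn_finite' F
    haveI := PLDClosure.disjointSum_finite' _ _ h
    ∀ lo hi δ Θ : ℕ, Θ ≤ lo + hi + δ → (lo = 0 ∨ lo + hi + δ ≤ Θ) →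
      (∑ I ∈ (gr (M.disjointSum (@Matroid.truncate α (Matroid.freeOn (F : Set α)) (PLDTruncate.freeOn_finite' F) 4) h)).powerset, (if lo ≤ ((M.disjointSum (@Matroid.truncate α (Matroid.freeOn (F : Set α)) (PLDTruncate.freeOn_finite' F) 4) h).eRk (I : Set α)).toNat ∧ ((M.disjointSum (@Matroid.truncate α (Matroid.freeOn (F : Set α)) (PLDTruncate.freeOn_finite' F) 4) h).eRk (I : Set α)).toNat ≤ hi ∧
          Θ ≤ ((M.disjointSum (@Matroid.truncate α (Matroid.freeOn (F : Set α)) (PLDTruncate.freeOn_finite' F) 4) h).eRk ((gr (M.disjointSum (@Matroid.truncate α (Matroid.freeOn (F : Set α)) (PLDTruncate.freeOn_finite' F) 4) h) \ I : Finset α) : Set α)).toNat + ((M.disjointSum (@Matroid.truncate α (Matroid.freeOn (F : Set α)) (PLDTruncate.freeOn_finite' F) 4) h).eRk (I : Set α)).toNat then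
          (((M.disjointSum (@Matroid.truncate α (Matroid.freeOn (F : Set α)) (PLDTruncate.freeOn_finite' F) 4) h).eRk ((gr (M.disjointSum (@Matroid.truncate α (Matroid.freeOn (F : Set α)) (PLDTruncate.freeOn_finite' F) 4) h) \ I : Finset α) : Set α)).toNat).choose δ else 0)) ≤
        ∑ I ∈ (gr (M.disjointSum (@Matroid.truncate α (Matroid.freeOn (F : Set α)) (PLDTruncate.freeOn_finite' F) 4) h)).powerset, (if lo + δ ≤ ((M.disjointSum (@Matroid.truncate α (Matroid.freeOn (F : Set α)) (PLDTruncate.freeOn_finite' F) 4) h).eRk ((gr (M.disjointSum (@Matroid.truncate α (Matroid.freeOn (F : Set α)) (PLDTruncate.freeOn_finite' F) 4) h) \ I : Finset α) : Set α)).toNat ∧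
          ((M.disjointSum (@Matroid.truncate α (Matroid.freeOn (F : Set α)) (PLDTruncate.freeOn_finite' F) 4) h).eRk ((gr (M.disjointSum (@Matroid.truncate α (Matroid.freeOn (F : Set α)) (PLDTruncate.freeOn_finite' F) 4) h) \ I : Finset α) : Set α)).toNat ≤ hi + δ then
          (((M.disjointSum (@Matroid.truncate α (Matroid.freeOn (F : Set α)) (PLDTruncate.freeOn_finite' F) 4) h).eRk ((gr (M.disjointSum (@Matroid.truncate α (Matroid.freeOn (F : Set α)) (PLDTruncate.freeOn_finite' F) 4) h) \ I : Finset α) : Set α)).toNat).choose δ else 0) :=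
  pld_disjointSum_uniform_four_ge_7_of_eRank_le_5 M (h3.trans (by norm_num)) (PLDParExt.pld_of_eRank_le_three M h3) F hF h

/-- C-025 AT EVERY `(p, q)` ON EVERY TRUNCATION OF «RANK ≤ 3 ⊕ ANY SOLID WITH ≥ 7 POINTS ⊕ FREE POINTS». -/
theorem rls_truncate_disjointSum_solid_freeOn_of_eRank_le_three (M : Matroid α) [M.Finite] (h3 : M.eRank ≤ 3)
    (F : Finset α) (hF : 7 ≤ F.card) (h : Disjoint M.E (@Matroid.truncate α (Matroid.freeOn (F : Set α)) (PLDTruncate.freeOn_finite' F) 4).E)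
    (E₃ : Finset α) (h₃ : Disjoint (M.disjointSum (@Matroid.truncate α (Matroid.freeOn (F : Set α)) (PLDTruncate.freeOn_finite' F) 4) h).E (E₃ : Set α)) (r p q : ℕ) :
    haveI := PLDTruncate.freeOn_finite' F
    haveI := PLDClosure.disjointSum_finite' _ _ h
    haveI := PLDBridge.disjointSum_freeOn_finite _ E₃ h₃
    ThmN.RLS (PercRepro.Matroid.truncate
      ((M.disjointSum (@Matroid.truncate α (Matroid.freeOn (F : Set α)) (PLDTruncate.freeOn_finite' F) 4) h).disjointSum (Matroid.freeOn (E₃ : Set α)) h₃) r) p q := by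
  haveI := PLDTruncate.freeOn_finite' F
  haveI := PLDClosure.disjointSum_finite' _ _ h
  exact PLDBridge.rls_disjointSum_freeOn_of_pld _ E₃ h₃ r p q (pld_disjointSum_solid_of_eRank_le_three M h3 F hF h)

/-- C-025 AT EVERY `(p, q)` ON EVERY TRUNCATION OF «(PLD)-MATROID OF RANK ≤ 5 ⊕ ANY SOLID WITH ≥ 7 POINTS ⊕ FREE POINTS». -/
theorem rls_truncate_disjointSum_solid_freeOn_of_pld (M : Matroid α) [M.Finite] (hr : M.eRank ≤ 5)
    (hPLD : ∀ lo hi δ Θ : ℕ, Θ ≤ lo + hi + δ → (lo = 0 ∨ lo + hi + δ ≤ Θ) →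
      (∑ I ∈ (gr M).powerset, (if lo ≤ (M.eRk (I : Set α)).toNat ∧ (M.eRk (I : Set α)).toNat ≤ hi ∧
          Θ ≤ (M.eRk ((gr M \ I : Finset α) : Set α)).toNat + (M.eRk (I : Set α)).toNat then
          ((M.eRk ((gr M \ I : Finset α) : Set α)).toNat).choose δ else 0)) ≤
        ∑ I ∈ (gr M).powerset, (if lo + δ ≤ (M.eRk ((gr M \ I : Finset α) : Set α)).toNat ∧
          (M.eRk ((gr M \ I : Finset α) : Set α)).toNat ≤ hi + δ then
          ((M.eRk ((gr M \ I : Finset α) : Set α)).toNat).choose δ else 0))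
    (F : Finset α) (hF : 7 ≤ F.card) (h : Disjoint M.E (@Matroid.truncate α (Matroid.freeOn (F : Set α)) (PLDTruncate.freeOn_finite' F) 4).E)
    (E₃ : Finset α) (h₃ : Disjoint (M.disjointSum (@Matroid.truncate α (Matroid.freeOn (F : Set α)) (PLDTruncate.freeOn_finite' F) 4) h).E (E₃ : Set α)) (r p q : ℕ) :
    haveI := PLDTruncate.freeOn_finite' F
    haveI := PLDClosure.disjointSum_finite' _ _ h
    haveI := PLDBridge.disjointSum_freeOn_finite _ E₃ h₃
    ThmN.RLS (PercRepro.Matroid.truncate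
      ((M.disjointSum (@Matroid.truncate α (Matroid.freeOn (F : Set α)) (PLDTruncate.freeOn_finite' F) 4) h).disjointSum (Matroid.freeOn (E₃ : Set α)) h₃) r) p q := by
  haveI := PLDTruncate.freeOn_finite' F
  haveI := PLDClosure.disjointSum_finite' _ _ h
  exact PLDBridge.rls_disjointSum_freeOn_of_pld _ E₃ h₃ r p q
    (pld_disjointSum_uniform_four_ge_7_of_eRank_le_5 M hr hPLD F hF h)

/-- C-025 AT EVERY `(p, q)` ON EVERY TRUNCATION OF «SIMPLIFICATION-PAVING OF RANK ≤ 5 ⊕ ANY SOLID WITH ≥ 7 POINTS ⊕ FREE POINTS». -/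
theorem rls_truncate_disjointSum_solid_freeOn_of_simplification_paving (M : Matroid α) [M.Finite] (hr : M.eRank ≤ 5)
    (hsp : ∀ C : Set α, M.IsCircuit C → C.encard ≤ 2 ∨ M.eRank ≤ C.encard)
    (F : Finset α) (hF : 7 ≤ F.card) (h : Disjoint M.E (@Matroid.truncate α (Matroid.freeOn (F : Set α)) (PLDTruncate.freeOn_finite' F) 4).E)
    (E₃ : Finset α) (h₃ : Disjoint (M.disjointSum (@Matroid.truncate α (Matroid.freeOn (F : Set α)) (PLDTruncate.freeOn_finite' F) 4) h).E (E₃ : Set α)) (r p q : ℕ) :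
    haveI := PLDTruncate.freeOn_finite' F
    haveI := PLDClosure.disjointSum_finite' _ _ h
    haveI := PLDBridge.disjointSum_freeOn_finite _ E₃ h₃
    ThmN.RLS (PercRepro.Matroid.truncate
      ((M.disjointSum (@Matroid.truncate α (Matroid.freeOn (F : Set α)) (PLDTruncate.freeOn_finite' F) 4) h).disjointSum (Matroid.freeOn (E₃ : Set α)) h₃) r) p q :=
  rls_truncate_disjointSum_solid_freeOn_of_pld M hr (PLDParExt.pld_of_simplification_paving M hsp) F hF h E₃ h₃ r p q

/-- (PLD) FOR «RANK ≤ 3 ⊕ A SOLID WITH ≥ 7 POINTS ⊕ ANY LINE» (unconditional; the solid first, then the line lift at rank ≤ 7). -/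
theorem pld_disjointSum_solid_line_of_eRank_le_three (M : Matroid α) [M.Finite] (h3 : M.eRank ≤ 3)
    (F₁ : Finset α) (hF₁ : 7 ≤ F₁.card) (h₁ : Disjoint M.E (@Matroid.truncate α (Matroid.freeOn (F₁ : Set α)) (PLDTruncate.freeOn_finite' F₁) 4).E)
    (F₂ : Finset α) (hF₂ : 4 ≤ F₂.card)
    (h₂ : Disjoint (@Matroid.disjointSum α M (@Matroid.truncate α (Matroid.freeOn (F₁ : Set α)) (PLDTruncate.freeOn_finite' F₁) 4) h₁).E (@Matroid.truncate α (Matroid.freeOn (F₂ : Set α)) (PLDTruncate.freeOn_finite' F₂) 2).E) :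
    haveI := PLDTruncate.freeOn_finite' F₁
    haveI := PLDTruncate.freeOn_finite' F₂
    haveI := PLDClosure.disjointSum_finite' _ _ h₁
    haveI := PLDClosure.disjointSum_finite' _ _ h₂
    ∀ lo hi δ Θ : ℕ, Θ ≤ lo + hi + δ → (lo = 0 ∨ lo + hi + δ ≤ Θ) →
      (∑ I ∈ (gr ((M.disjointSum (@Matroid.truncate α (Matroid.freeOn (F₁ : Set α)) (PLDTruncate.freeOn_finite' F₁) 4) h₁).disjointSum (@Matroid.truncate α (Matroid.freeOn (F₂ : Set α)) (PLDTruncate.freeOn_finite' F₂) 2) h₂)).powerset, (if lo ≤ (((M.disjointSum (@Matroid.truncate α (Matroid.freeOn (F₁ : Set α)) (PLDTruncate.freeOn_finite' F₁) 4) h₁).disjointSum (@Matroid.truncate α (Matroid.freeOn (F₂ : Set α)) (PLDTruncate.freeOn_finite' F₂) 2) h₂).eRk (I : Set α)).toNat ∧ (((M.disjointSum (@Matroid.truncate α (Matroid.freeOn (F₁ : Set α)) (PLDTruncate.freeOn_finite' F₁) 4) h₁).disjointSum (@Matroid.truncate α (Matroid.freeOn (F₂ : Set α)) (PLDTruncate.freeOn_finite'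 F₂) 2) h₂).eRk (I : Set α)).toNat ≤ hi ∧
          Θ ≤ (((M.disjointSum (@Matroid.truncate α (Matroid.freeOn (F₁ : Set α)) (PLDTruncate.freeOn_finite' F₁) 4) h₁).disjointSum (@Matroid.truncate α (Matroid.freeOn (F₂ : Set α)) (PLDTruncate.freeOn_finite' F₂) 2) h₂).eRk ((gr ((M.disjointSum (@Matroid.truncate α (Matroid.freeOn (F₁ : Set α)) (PLDTruncate.freeOn_finite' F₁) 4) h₁).disjointSum (@Matroid.truncate α (Matroid.freeOn (F₂ : Set α)) (PLDTruncate.freeOn_finite' F₂) 2) h₂) \ I : Finset α) : Set α)).toNat + (((M.disjointSum (@Matroid.truncate α (Matroid.freeOn (F₁ : Set α)) (PLDTruncate.freeOn_finite' F₁) 4) h₁).disjointSum (@Matroid.truncate α (Matroid.freeOn (F₂ : Set α)) (PLDTruncate.freeOn_finite' F₂) 2) h₂).eRk (I : Set α)).toNat then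
          ((((M.disjointSum (@Matroid.truncate α (Matroid.freeOn (F₁ : Set α)) (PLDTruncate.freeOn_finite' F₁) 4) h₁).disjointSum (@Matroid.truncate α (Matroid.freeOn (F₂ : Set α)) (PLDTruncate.freeOn_finite' F₂) 2) h₂).eRk ((gr ((M.disjointSum (@Matroid.truncate α (Matroid.freeOn (F₁ : Set α)) (PLDTruncate.freeOn_finite' F₁) 4) h₁).disjointSum (@Matroid.truncate α (Matroid.freeOn (F₂ : Set α)) (PLDTruncate.freeOn_finite' F₂) 2) h₂) \ I : Finset α) : Set α)).toNat).choose δ else 0)) ≤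
        ∑ I ∈ (gr ((M.disjointSum (@Matroid.truncate α (Matroid.freeOn (F₁ : Set α)) (PLDTruncate.freeOn_finite' F₁) 4) h₁).disjointSum (@Matroid.truncate α (Matroid.freeOn (F₂ : Set α)) (PLDTruncate.freeOn_finite' F₂) 2) h₂)).powerset, (if lo + δ ≤ (((M.disjointSum (@Matroid.truncate α (Matroid.freeOn (F₁ : Set α)) (PLDTruncate.freeOn_finite' F₁) 4) h₁).disjointSum (@Matroid.truncate α (Matroid.freeOn (F₂ : Set α)) (PLDTruncate.freeOn_finite' F₂) 2) h₂).eRk ((gr ((M.disjointSum (@Matroid.truncate α (Matroid.freeOn (F₁ : Set α)) (PLDTruncate.freeOn_finite' F₁) 4) h₁).disjointSum (@Matroid.truncate α (Matroid.freeOn (F₂ : Set α)) (PLDTruncate.freeOn_finite' F₂) 2) h₂) \ I : Finset α) : Set α)).toNat ∧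
          (((M.disjointSum (@Matroid.truncate α (Matroid.freeOn (F₁ : Set α)) (PLDTruncate.freeOn_finite' F₁) 4) h₁).disjointSum (@Matroid.truncate α (Matroid.freeOn (F₂ : Set α)) (PLDTruncate.freeOn_finite' F₂) 2) h₂).eRk ((gr ((M.disjointSum (@Matroid.truncate α (Matroid.freeOn (F₁ : Set α)) (PLDTruncate.freeOn_finite' F₁) 4) h₁).disjointSum (@Matroid.truncate α (Matroid.freeOn (F₂ : Set α)) (PLDTruncate.freeOn_finite' F₂) 2) h₂) \ I : Finset α) : Set α)).toNat ≤ hi + δ then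
          ((((M.disjointSum (@Matroid.truncate α (Matroid.freeOn (F₁ : Set α)) (PLDTruncate.freeOn_finite' F₁) 4) h₁).disjointSum (@Matroid.truncate α (Matroid.freeOn (F₂ : Set α)) (PLDTruncate.freeOn_finite' F₂) 2) h₂).eRk ((gr ((M.disjointSum (@Matroid.truncate α (Matroid.freeOn (F₁ : Set α)) (PLDTruncate.freeOn_finite' F₁) 4) h₁).disjointSum (@Matroid.truncate α (Matroid.freeOn (F₂ : Set α)) (PLDTruncate.freeOn_finite' F₂) 2) h₂) \ I : Finset α) : Set α)).toNat).choose δ else 0) := by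
  haveI := PLDTruncate.freeOn_finite' F₁
  haveI := PLDTruncate.freeOn_finite' F₂
  haveI := PLDClosure.disjointSum_finite' _ _ h₁
  have h1 := pld_disjointSum_solid_of_eRank_le_three M h3 F₁ hF₁ h₁
  have hr1 : (M.disjointSum (@Matroid.truncate α (Matroid.freeOn (F₁ : Set α)) (PLDTruncate.freeOn_finite' F₁) 4) h₁).eRank ≤ 7 := by
    rw [PLDTwoLiftGen.eRank_disjointSum]
    calc M.eRank + (@Matroid.truncate α (Matroid.freeOn (F₁ : Set α)) (PLDTruncate.freeOn_finite' F₁) 4).eRank ≤ 3 + 4 := add_le_add h3 (eRank_solid_le F₁)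
      _ = 7 := by norm_num
  exact PLDTwoLiftGen.pld_disjointSum_uniform_two_ge_4_of_eRank_le_7 _ hr1 h1 F₂ hF₂ h₂

/-- C-025 AT EVERY `(p, q)` ON EVERY TRUNCATION OF «RANK ≤ 3 ⊕ A SOLID WITH ≥ 7 POINTS ⊕ ANY LINE ⊕ FREE POINTS». -/
theorem rls_truncate_disjointSum_solid_line_freeOn_of_eRank_le_three (M : Matroid α) [M.Finite] (h3 : M.eRank ≤ 3)
    (F₁ : Finset α) (hF₁ : 7 ≤ F₁.card) (h₁ : Disjoint M.E (@Matroid.truncate α (Matroid.freeOn (F₁ : Set α)) (PLDTruncate.freeOn_finite' F₁) 4).E)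
    (F₂ : Finset α) (hF₂ : 4 ≤ F₂.card)
    (h₂ : Disjoint (@Matroid.disjointSum α M (@Matroid.truncate α (Matroid.freeOn (F₁ : Set α)) (PLDTruncate.freeOn_finite' F₁) 4) h₁).E (@Matroid.truncate α (Matroid.freeOn (F₂ : Set α)) (PLDTruncate.freeOn_finite' F₂) 2).E)
    (E₃ : Finset α) (h₃ : Disjoint ((M.disjointSum (@Matroid.truncate α (Matroid.freeOn (F₁ : Set α)) (PLDTruncate.freeOn_finite' F₁) 4) h₁).disjointSum (@Matroid.truncate α (Matroid.freeOn (F₂ : Set α)) (PLDTruncate.freeOn_finite' F₂) 2) h₂).E (E₃ : Set α)) (r p q : ℕ) :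
    haveI := PLDTruncate.freeOn_finite' F₁
    haveI := PLDTruncate.freeOn_finite' F₂
    haveI := PLDClosure.disjointSum_finite' _ _ h₁
    haveI := PLDClosure.disjointSum_finite' _ _ h₂
    haveI := PLDBridge.disjointSum_freeOn_finite _ E₃ h₃
    ThmN.RLS (PercRepro.Matroid.truncate (((M.disjointSum (@Matroid.truncate α (Matroid.freeOn (F₁ : Set α)) (PLDTruncate.freeOn_finite' F₁) 4) h₁).disjointSum (@Matroid.truncate α (Matroid.freeOn (F₂ : Set α)) (PLDTruncate.freeOn_finite' F₂) 2) h₂).disjointSum (Matroid.freeOn (E₃ : Set α)) h₃) r) p q := by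
  haveI := PLDTruncate.freeOn_finite' F₁
  haveI := PLDTruncate.freeOn_finite' F₂
  haveI := PLDClosure.disjointSum_finite' _ _ h₁
  haveI := PLDClosure.disjointSum_finite' _ _ h₂
  exact PLDBridge.rls_disjointSum_freeOn_of_pld _ E₃ h₃ r p q
    (pld_disjointSum_solid_line_of_eRank_le_three M h3 F₁ hF₁ h₁ F₂ hF₂ h₂)

end PLDSolidLift

end PercRepro
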